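import Summits.Ventures.Crystal3D.Theorems.StickyWulffConstantCoaxialWallLawAutomatonCore
import Summits.Ventures.Crystal3D.Theorems.StickyWulffConstantCoaxialWallLawSources
import Summits.Ventures.Crystal3D.Theorems.StickyWulffConstantCoaxialWallLawBandCount
import Summits.Ventures.Crystal3D.Theorems.StickyWulffConstantCoaxialWallLawTwinFrames
import HarnessLib

/-!
# The flux gap in the co-axial twin cell: payers ≥ (2√2 δ* π ρ² − #foreign − O((1+h)ρ))/26

HONEST FRAMING. Part of the venture `Summits/Ventures/Crystal3D` (cell `crystal3d-full`), helper for the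
crux `CoaxialWallLaw` (stmt-Ventures-19481) of `route-Ventures-StickyWulffConstant`, REGISTERED line
`WallLedgerF` (planner cf-p1 gen 16), open stub `stub_coaxialTwoSlabAdhesion` (general fillings).  Brick 11
of the FLUX-GAP architecture (memo F-FLUXGAP-ARCH §2): the automaton INSTANTIATED for a co-axial twin pair
in normal form (frames `F false`, `F true` = `L`, `L∘R` in either order, axis `n = ±L e₃`), with the
designated slot `F c u⋆` in both classes (`u⋆` a far slot of the axis: steep in the bottom grain, shallow in
the twin).  Rung credit only; F-C1 not moved.

**Theorem (`fluxGap_twin_payers_ge`).**  In the two-slab cell (`X` `1`-separated in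
`{−2R₀ ≤ x₂ ≤ h + 2R₀, lateral ≤ ρ}`, `10 ≤ R₀ ≤ ρ`, samples `P₁ ⊆ F false·Λ₀ + s₁`, `P₂ ⊆ F true·Λ₀ + s₂`
complete in their windows; inputs `KissingGap δ`, `KissingClassification δ` by name), writing
`α₁ = (F false u⋆)₂ > 0`, `α₂ = (F true u⋆)₂ > 0` (so `α₁ − α₂ = 2δ⋆`) and `K = (R₀ − 1)/2 + 4`:
`√2 (α₁ − α₂) π ρ² − (12√2π + 2√2πK + 36R₀ + 288) ρ − √2 π K²/α₂
   ≤ 26 · #{z ∈ X : deg z ≤ 11, −R₀ − 2 ≤ z₂ ≤ h + R₀ + 2} + 2 · #FOREIGN`,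
where `FOREIGN` = balls of `X` that are twin dozens of one of the two frames for a `{111}` normal
`n′ ≠ ±n` (the residual).  Sources `card_vertical_tops_ge`, count `card_sources_le_automaton`, band
`card_band_le_lineCount`, rim `card_mul_le_of_separated_in_shell`.

WHAT THIS IS NOT: not the stub (next file converts payers into deficiency and the stub's shape); F-C1 not
moved.
-/

noncomputable section

namespace Summit.Ventures.Crystal3D.Theorems

open Summit.Ventures.Crystal3D Finset
open Literature.MathematicalPhysics.StatisticalMechanics (fccStacking)
open scoped InnerProductSpace

open scoped Classical in
/-- **The flux gap feeds the payers (co-axial twin cell, normal form).**  See the module docstring. -/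
theorem fluxGap_twin_payers_ge {δ : ℝ} (hg : KissingGap δ) (hc : KissingClassification δ)
    (L : EuclideanSpace ℝ (Fin 3) ≃ₗᵢ[ℝ] EuclideanSpace ℝ (Fin 3))
    (F : Bool → (EuclideanSpace ℝ (Fin 3) ≃ₗᵢ[ℝ] EuclideanSpace ℝ (Fin 3)))
    (hF : (F false = L ∧ F true = (ℝ ∙ EuclideanSpace.single (2 : Fin 3) (1 : ℝ)).reflection.trans L) ∨
      (F false = (ℝ ∙ EuclideanSpace.single (2 : Fin 3) (1 : ℝ)).reflection.trans L ∧ F true = L))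
    {n : EuclideanSpace ℝ (Fin 3)}
    (hn : n = L (EuclideanSpace.single (2 : Fin 3) (1 : ℝ)) ∨ n = -L (EuclideanSpace.single (2 : Fin 3) (1 : ℝ)))
    {ustar : EuclideanSpace ℝ (Fin 3)} (hustar : ustar ∈ fccSlots) (hfar : ⟪F false ustar, n⟫_ℝ = Real.sqrt (2 / 3))
    (hα₁ : 0 < (F false ustar) 2) (hα₂ : 0 < (F true ustar) 2)
    (s₁ s₂ : EuclideanSpace ℝ (Fin 3)) (X P₁ P₂ : Finset (EuclideanSpace ℝ (Fin 3))) (R₀ h ρ : ℝ)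
    (hR₀ : 10 ≤ R₀) (hh : 0 ≤ h) (hρ : R₀ ≤ ρ)
    (hX : ∀ p ∈ X, ∀ q ∈ X, p ≠ q → 1 ≤ dist p q)
    (hcell : ∀ p ∈ X, -(2 * R₀) ≤ p 2 ∧ p 2 ≤ h + 2 * R₀ ∧ p 0 ^ 2 + p 1 ^ 2 ≤ ρ ^ 2)
    (hP₁X : P₁ ⊆ X) (hP₂X : P₂ ⊆ X)
    (hP₁ : ∀ p, p ∈ P₁ ↔ (p ∈ (fun q => F false q + s₁) '' fccStacking 1 (Real.sqrt (2 / 3)) ∧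
      -(2 * R₀) ≤ p 2 ∧ p 2 ≤ -R₀ ∧ p 0 ^ 2 + p 1 ^ 2 ≤ ρ ^ 2))
    (hP₂ : ∀ p, p ∈ P₂ ↔ (p ∈ (fun q => F true q + s₂) '' fccStacking 1 (Real.sqrt (2 / 3)) ∧
      h + R₀ ≤ p 2 ∧ p 2 ≤ h + 2 * R₀ ∧ p 0 ^ 2 + p 1 ^ 2 ≤ ρ ^ 2)) :
    Real.sqrt 2 * ((F false ustar) 2 - (F true ustar) 2) * Real.pi * ρ ^ 2 -
        (12 * Real.sqrt 2 * Real.pi + 2 * Real.sqrt 2 * Real.pi * ((R₀ - 1) / 2 + 4) + 36 * R₀ + 288) * ρ -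
        Real.sqrt 2 * Real.pi * ((R₀ - 1) / 2 + 4) ^ 2 / (F true ustar) 2 ≤
      26 * ((X.filter fun z => (X.filter fun q => dist z q = 1).card ≤ 11 ∧
          -R₀ - 2 ≤ z 2 ∧ z 2 ≤ h + R₀ + 2).card : ℝ) +
      2 * ((X.filter fun b => ∃ c : Bool, ∃ n' : EuclideanSpace ℝ (Fin 3), ‖n'‖ = 1 ∧ n' ≠ n ∧ n' ≠ -n ∧
          (∀ w ∈ fccSlots, ⟪F c w, n'⟫_ℝ = 0 ∨ ⟪F c w, n'⟫_ℝ = Real.sqrt (2 / 3) ∨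
            ⟪F c w, n'⟫_ℝ = -Real.sqrt (2 / 3)) ∧
          (∀ w ∈ fccSlots, ⟪F c w, n'⟫_ℝ ≤ 0 → b + F c w ∈ X) ∧
          (∀ w ∈ fccSlots, ⟪F c w, n'⟫_ℝ < 0 → b + (F c w - (2 * ⟪F c w, n'⟫_ℝ) • n') ∈ X) ∧
          (∀ w ∈ fccSlots, 0 < ⟪F c w, n'⟫_ℝ → b + F c w ∉ X)).card : ℝ) := by
  set e₃ : EuclideanSpace ℝ (Fin 3) := EuclideanSpace.single (2 : Fin 3) (1 : ℝ) with he₃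
  set RL := (ℝ ∙ EuclideanSpace.single (2 : Fin 3) (1 : ℝ)).reflection.trans L with hRL
  have hr : 0 < Real.sqrt (2 / 3) := Real.sqrt_pos.2 (by norm_num)
  have hR₀3 : (3 : ℝ) ≤ R₀ := by linarith
  have hρ0 : (0 : ℝ) ≤ ρ := by linarith
  -- the axis: unit, and `⟪F c w, n⟫ = ± w₂`
  have hn1 : ‖n‖ = 1 := by
    rcases hn with rfl | rfl
    · rw [LinearIsometryEquiv.norm_map, he₃, PiLp.norm_single, norm_one]
    · rw [norm_neg, LinearIsometryEquiv.norm_map, he₃, PiLp.norm_single, norm_one]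
  have hax : ∀ c w, ⟪F c w, L e₃⟫_ℝ = w 2 := by
    intro c w
    rcases hF with ⟨h0, h1⟩ | ⟨h0, h1⟩ <;> cases c <;> simp only [h0, h1]
    · exact inner_frame_axis L w
    · exact inner_twinFrame_axis L w
    · exact inner_twinFrame_axis L w
    · exact inner_frame_axis L w
  have haxn : ∀ c w, ⟪F c w, n⟫_ℝ = w 2 ∨ ⟪F c w, n⟫_ℝ = -w 2 := by
    intro c w
    rcases hn with rfl | rfl
    · exact Or.inl (hax c w)
    · exact Or.inr (by rw [inner_neg_right, hax])
  have hmenu : ∀ c, ∀ w ∈ fccSlots,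
      ⟪F c w, n⟫_ℝ = 0 ∨ ⟪F c w, n⟫_ℝ = Real.sqrt (2 / 3) ∨ ⟪F c w, n⟫_ℝ = -Real.sqrt (2 / 3) := by
    intro c w hw
    rcases haxn c w with h | h <;> rcases slot_apply_two_cases hw with h' | h' | h' <;> rw [h, h']
    · exact Or.inl rfl
    · exact Or.inr (Or.inl rfl)
    · exact Or.inr (Or.inr rfl)
    · exact Or.inl neg_zero
    · exact Or.inr (Or.inr rfl)
    · exact Or.inr (Or.inl (neg_neg _))
  -- the mirror relation with `w' = −w`
  have hmir : ∀ c, ∀ w ∈ fccSlots, ∃ w' ∈ fccSlots, F (!c) w' = F c w - (2 * ⟪F c w, n⟫_ℝ) • n := by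
    intro c w hw
    refine ⟨-w, neg_mem_fccSlots hw, ?_⟩
    rcases hF with ⟨h0, h1⟩ | ⟨h0, h1⟩ <;> cases c <;> simp only [Bool.not_false, Bool.not_true, h0, h1]
    · exact twinFrame_neg_eq L hn w
    · exact frame_neg_eq L hn w
    · exact frame_neg_eq L hn w
    · exact twinFrame_neg_eq L hn w
  -- `u⋆` is far for both frames and non-horizontal
  have hfar' : ∀ c, ⟪F c ustar, n⟫_ℝ = Real.sqrt (2 / 3) := by
    intro c
    have h0 := haxn false ustar
    have h1 := haxn c ustar
    rcases hn with hn' | hn'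
    · rw [hn', hax] at hfar ⊢; exact hfar
    · rw [hn', inner_neg_right, hax] at hfar ⊢; exact hfar
  have hu2 : ustar 2 ≠ 0 := by
    intro h0
    rcases haxn false ustar with h | h <;> rw [h, h0] at hfar
    · exact hr.ne' hfar.symm
    · rw [neg_zero] at hfar; exact hr.ne' hfar.symm
  -- predicates and designated vectors
  set Full : Bool → EuclideanSpace ℝ (Fin 3) → Prop := fun c b => ∀ w ∈ fccSlots, b + F c w ∈ X with hFulldef
  set TD : Bool → EuclideanSpace ℝ (Fin 3) → Prop := fun c b =>
    (∀ w ∈ fccSlots, ⟪F c w, n⟫_ℝ ≤ 0 → b + F c w ∈ X) ∧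
    (∀ w ∈ fccSlots, ⟪F c w, n⟫_ℝ < 0 → b + (F c w - (2 * ⟪F c w, n⟫_ℝ) • n) ∈ X) ∧
    (∀ w ∈ fccSlots, 0 < ⟪F c w, n⟫_ℝ → b + F c w ∉ X) with hTDdef
  set Inv : Bool → EuclideanSpace ℝ (Fin 3) → Prop := fun c b => ∃ a ∈ fccSlots, ∃ a' ∈ fccSlots, ∃ a'' ∈ fccSlots,
    LinearIndependent ℝ ![a, a', a''] ∧ b + F c a ∈ X ∧ b + F c a' ∈ X ∧ b + F c a'' ∈ X with hInvdef
  set dsg : Bool → EuclideanSpace ℝ (Fin 3) → EuclideanSpace ℝ (Fin 3) := fun c _ => F c ustar with hdsgdef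
  have hFull : ∀ c b, Full c b ↔ ∀ w ∈ fccSlots, b + F c w ∈ X := fun c b => Iff.rfl
  have hTD : ∀ c b, TD c b ↔
      ((∀ w ∈ fccSlots, ⟪F c w, n⟫_ℝ ≤ 0 → b + F c w ∈ X) ∧
       (∀ w ∈ fccSlots, ⟪F c w, n⟫_ℝ < 0 → b + (F c w - (2 * ⟪F c w, n⟫_ℝ) • n) ∈ X) ∧
       (∀ w ∈ fccSlots, 0 < ⟪F c w, n⟫_ℝ → b + F c w ∉ X)) := fun c b => Iff.rfl
  have hInv : ∀ c b, Inv c b ↔ ∃ a ∈ fccSlots, ∃ a' ∈ fccSlots, ∃ a'' ∈ fccSlots,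
      LinearIndependent ℝ ![a, a', a''] ∧ b + F c a ∈ X ∧ b + F c a' ∈ X ∧ b + F c a'' ∈ X := fun c b => Iff.rfl
  have hdsg_up : ∀ c b, ∃ u ∈ fccSlots, ⟪F c u, n⟫_ℝ = Real.sqrt (2 / 3) ∧ dsg c b = F c u :=
    fun c b => ⟨ustar, hustar, hfar' c, rfl⟩
  have hdsg_inv : ∀ c b, ∀ w ∈ fccStacking 1 (Real.sqrt (2 / 3)), dsg c (b + F c w) = dsg c b :=
    fun c b w _ => rfl
  have hrise : ∀ c b, 0 < dsg c b 2 := by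
    intro c b; cases c
    · exact hα₁
    · exact hα₂
  set f : EuclideanSpace ℝ (Fin 3) × Bool → EuclideanSpace ℝ (Fin 3) × Bool := fun v =>
    @ite _ (Full v.2 v.1) (Classical.propDecidable _) (v.1 + dsg v.2 v.1, v.2)
      (v.1 + dsg (!v.2) v.1, !v.2) with hfdef
  -- the inner sample and the state space
  set zlo : ℝ := -R₀ - 1 with hzlo
  set zcut : ℝ := h + R₀ + 1 with hzcut
  set P' : Finset (EuclideanSpace ℝ (Fin 3)) := P₁.filter fun p =>
    -(2 * R₀) + 1 ≤ p 2 ∧ p 2 ≤ -R₀ - 1 ∧ p 0 ^ 2 + p 1 ^ 2 ≤ (ρ - 1) ^ 2 with hP'def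
  have hP'iff : ∀ p, p ∈ P' ↔ (p ∈ (fun q => F false q + s₁) '' fccStacking 1 (Real.sqrt (2 / 3)) ∧
      -(2 * R₀) + 1 ≤ p 2 ∧ p 2 ≤ -R₀ - 1 ∧ p 0 ^ 2 + p 1 ^ 2 ≤ (ρ - 1) ^ 2) := by
    intro p
    rw [hP'def, mem_filter, hP₁]
    constructor
    · rintro ⟨⟨hΛ, -, -, -⟩, h1, h2, h3⟩; exact ⟨hΛ, h1, h2, h3⟩
    · rintro ⟨hΛ, h1, h2, h3⟩
      have hρ1 : (0 : ℝ) ≤ ρ - 1 := by linarith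
      exact ⟨⟨hΛ, by linarith, by linarith, by nlinarith⟩, h1, h2, h3⟩
  have hP'X : P' ⊆ X := (filter_subset _ _).trans hP₁X
  have hP'top : ∀ p ∈ P', p 2 ≤ zlo := fun p hp => by rw [hzlo]; exact ((hP'iff p).1 hp).2.2.1
  have hsrc : ∀ p ∈ P', dsg false p = F false ustar := fun p _ => rfl
  set V : Finset (EuclideanSpace ℝ (Fin 3) × Bool) := (X ×ˢ (univ : Finset Bool)).filter fun v =>
    zlo ≤ v.1 2 ∧ v.1 2 < zcut ∧ v.1 ∉ P' ∧ Inv v.2 v.1 ∧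
      ∃ w ∈ fccSlots, ⟪F v.2 w, n⟫_ℝ < 0 ∧ v.1 + F v.2 w ∈ X with hVdef
  have hV : ∀ v, v ∈ V ↔ (v.1 ∈ X ∧ zlo ≤ v.1 2 ∧ v.1 2 < zcut ∧ v.1 ∉ P' ∧ Inv v.2 v.1 ∧
      ∃ w ∈ fccSlots, ⟪F v.2 w, n⟫_ℝ < 0 ∧ v.1 + F v.2 w ∈ X) := by
    intro v
    rw [hVdef, mem_filter, mem_product]
    simp only [mem_univ, and_true]
  -- the top sample data for `…AutomatonTrans`
  have hcell' : ∀ p ∈ X, p 2 ≤ h + 2 * R₀ ∧ p 0 ^ 2 + p 1 ^ 2 ≤ ρ ^ 2 :=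
    fun p hp => ⟨(hcell p hp).2.1, (hcell p hp).2.2⟩
  have hsh : ∀ b ∈ (fun q => F true q + s₂) '' fccStacking 1 (Real.sqrt (2 / 3)), dsg true b = F true ustar :=
    fun b _ => rfl
  have hnon : ∀ b, ∀ w ∈ fccSlots, dsg (!true) b ≠ F true w := by
    intro b w hw
    show F false ustar ≠ F true w
    rcases hF with ⟨h0, h1⟩ | ⟨h0, h1⟩ <;> rw [h0, h1]
    · exact (frame_ne_twinFrame L hustar hu2 hw).1
    · exact (frame_ne_twinFrame L hustar hu2 hw).2
  -- (1) the automaton count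
  have hcore := card_sources_le_automaton (f := f) (cΛ := true) hg hc hX hn1 hmenu hmir hFull hTD hInv hdsg_up
    hdsg_inv hrise (fun v => rfl) hV hP'X hP'top hsrc hR₀3 hρ rfl hcell' hP₂X hP₂ hsh hnon
  -- (2) the sources
  have hsources := card_vertical_tops_ge (F false) s₁ X P₁ P' R₀ ρ zcut hR₀3 hρ (by rw [hzcut]; linarith)
    hX hP₁X hP₁ hP'iff hustar (by rw [← apply_two_eq_inner_e₃]; exact hα₁.le)
  -- (3) the band
  have hband := card_band_le_lineCount (F true) s₂ P₂ h R₀ ρ zcut hρ0 (by rw [hzcut]; linarith)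
    (by rw [hzcut]; linarith) hP₂ hustar (by rw [← apply_two_eq_inner_e₃]; exact hα₂)
  -- (4) the rim band
  set RIMT := X.filter fun s => zcut ≤ s 2 ∧ s 2 ≤ zcut + 1 ∧ (ρ - 2) ^ 2 < s 0 ^ 2 + s 1 ^ 2 with hRIMT
  have hrim : (RIMT.card : ℝ) ≤ 144 * ρ := by
    have hsep : ∀ p ∈ RIMT, ∀ q ∈ RIMT, p ≠ q → 1 ≤ dist p q :=
      fun p hp q hq hpq => hX p (mem_filter.1 hp).1 q (mem_filter.1 hq).1 hpq
    have hmem : ∀ p ∈ RIMT, zcut ≤ p 2 ∧ p 2 ≤ zcut + 1 ∧ (ρ - 2) ^ 2 < p 0 ^ 2 + p 1 ^ 2 ∧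
        p 0 ^ 2 + p 1 ^ 2 ≤ ρ ^ 2 := by
      intro p hp
      obtain ⟨hpX, h1, h2, h3⟩ := mem_filter.1 hp
      exact ⟨h1, h2, h3, (hcell p hpX).2.2⟩
    have key := card_mul_le_of_separated_in_shell RIMT hsep zcut (zcut + 1) (ρ - 2) ρ (by linarith)
      (by linarith) (by linarith) hmem
    have e : (zcut + 1 - zcut + 2) * (Real.pi * (ρ + 1) ^ 2 - Real.pi * (ρ - 2 - 1) ^ 2) =
        (Real.pi / 6) * (144 * ρ - 144) := by ring
    rw [e] at key
    have hπ : 0 < Real.pi / 6 := by positivity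
    have := le_of_mul_le_mul_right (by linarith [key] : (RIMT.card : ℝ) * (Real.pi / 6) ≤
      (144 * ρ - 144) * (Real.pi / 6)) hπ
    linarith
  -- (5) the states of foreign twin dozens are at most two per ball
  set FORb := X.filter fun b => ∃ c : Bool, ∃ n' : EuclideanSpace ℝ (Fin 3), ‖n'‖ = 1 ∧ n' ≠ n ∧ n' ≠ -n ∧
      (∀ w ∈ fccSlots, ⟪F c w, n'⟫_ℝ = 0 ∨ ⟪F c w, n'⟫_ℝ = Real.sqrt (2 / 3) ∨
        ⟪F c w, n'⟫_ℝ = -Real.sqrt (2 / 3)) ∧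
      (∀ w ∈ fccSlots, ⟪F c w, n'⟫_ℝ ≤ 0 → b + F c w ∈ X) ∧
      (∀ w ∈ fccSlots, ⟪F c w, n'⟫_ℝ < 0 → b + (F c w - (2 * ⟪F c w, n'⟫_ℝ) • n') ∈ X) ∧
      (∀ w ∈ fccSlots, 0 < ⟪F c w, n'⟫_ℝ → b + F c w ∉ X) with hFORb
  have hfor : (V.filter fun v => ∃ n' : EuclideanSpace ℝ (Fin 3), ‖n'‖ = 1 ∧ n' ≠ n ∧ n' ≠ -n ∧
        (∀ w ∈ fccSlots, ⟪F v.2 w, n'⟫_ℝ = 0 ∨ ⟪F v.2 w, n'⟫_ℝ = Real.sqrt (2 / 3) ∨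
          ⟪F v.2 w, n'⟫_ℝ = -Real.sqrt (2 / 3)) ∧
        (∀ w ∈ fccSlots, ⟪F v.2 w, n'⟫_ℝ ≤ 0 → v.1 + F v.2 w ∈ X) ∧
        (∀ w ∈ fccSlots, ⟪F v.2 w, n'⟫_ℝ < 0 → v.1 + (F v.2 w - (2 * ⟪F v.2 w, n'⟫_ℝ) • n') ∈ X) ∧
        (∀ w ∈ fccSlots, 0 < ⟪F v.2 w, n'⟫_ℝ → v.1 + F v.2 w ∉ X)).card ≤ 2 * FORb.card := by
    have hsub : (V.filter fun v => ∃ n' : EuclideanSpace ℝ (Fin 3), ‖n'‖ = 1 ∧ n' ≠ n ∧ n' ≠ -n ∧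
        (∀ w ∈ fccSlots, ⟪F v.2 w, n'⟫_ℝ = 0 ∨ ⟪F v.2 w, n'⟫_ℝ = Real.sqrt (2 / 3) ∨
          ⟪F v.2 w, n'⟫_ℝ = -Real.sqrt (2 / 3)) ∧
        (∀ w ∈ fccSlots, ⟪F v.2 w, n'⟫_ℝ ≤ 0 → v.1 + F v.2 w ∈ X) ∧
        (∀ w ∈ fccSlots, ⟪F v.2 w, n'⟫_ℝ < 0 → v.1 + (F v.2 w - (2 * ⟪F v.2 w, n'⟫_ℝ) • n') ∈ X) ∧
        (∀ w ∈ fccSlots, 0 < ⟪F v.2 w, n'⟫_ℝ → v.1 + F v.2 w ∉ X)) ⊆ FORb ×ˢ (univ : Finset Bool) := by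
      intro v hv
      rw [mem_filter] at hv
      obtain ⟨hvV, n', h1, h2, h3, h4, h5, h6, h7⟩ := hv
      rw [mem_product, hFORb, mem_filter]
      exact ⟨⟨((hV v).1 hvV).1, v.2, n', h1, h2, h3, h4, h5, h6, h7⟩, mem_univ _⟩
    have := card_le_card hsub
    rw [card_product, card_univ, Fintype.card_bool] at this
    omega
  -- (6) arithmetic
  set α₁ := (F false ustar) 2 with hα₁def
  set α₂ := (F true ustar) 2 with hα₂def
  set K := (R₀ - 1) / 2 + 4 with hKdef
  have hα₁' : ⟪F false ustar, EuclideanSpace.single (2 : Fin 3) (1 : ℝ)⟫_ℝ = α₁ := (apply_two_eq_inner_e₃ _).symm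
  have hα₂' : ⟪F true ustar, EuclideanSpace.single (2 : Fin 3) (1 : ℝ)⟫_ℝ = α₂ := (apply_two_eq_inner_e₃ _).symm
  have hα₁le : α₁ ≤ 1 := by
    rw [← hα₁']; exact (abs_le.1 (abs_inner_slot_le_one (F false) hustar)).2
  rw [hα₁', abs_of_pos hα₁] at hsources
  rw [hα₂'] at hband
  have hzK : (h + 2 * R₀ - zcut) / 2 + 4 = K := by rw [hzcut, hKdef]; ring
  rw [hzK] at hband
  -- the integer count, cast to ℝ
  have hcoreR := hcore
  have hcast : ((P'.filter fun p => (∀ w ∈ fccSlots, p + F false w ∈ X) ∧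
      zlo < (p + F false ustar) 2 ∧ (p + F false ustar) 2 < zcut).card : ℝ) ≤
      26 * ((X.filter fun z => (X.filter fun q => dist z q = 1).card ≤ 11 ∧
          zlo - 1 ≤ z 2 ∧ z 2 ≤ zcut + 1).card : ℝ) + (2 * FORb.card : ℕ) +
      ((P₂.filter fun s => zcut ≤ s 2 ∧ s 2 < zcut + α₂).card : ℝ) + 2 * (RIMT.card : ℝ) := by
    have h0 : (P'.filter fun p => (∀ w ∈ fccSlots, p + F false w ∈ X) ∧
        zlo < (p + F false ustar) 2 ∧ (p + F false ustar) 2 < zcut).card ≤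
        26 * (X.filter fun z => (X.filter fun q => dist z q = 1).card ≤ 11 ∧
          zlo - 1 ≤ z 2 ∧ z 2 ≤ zcut + 1).card + 2 * FORb.card +
        (P₂.filter fun s => zcut ≤ s 2 ∧ s 2 < zcut + α₂).card + 2 * RIMT.card := by
      have := hcoreR; omega
    exact_mod_cast h0
  -- identify the payer windows
  have hPAYeq : (X.filter fun z => (X.filter fun q => dist z q = 1).card ≤ 11 ∧
      zlo - 1 ≤ z 2 ∧ z 2 ≤ zcut + 1) = (X.filter fun z => (X.filter fun q => dist z q = 1).card ≤ 11 ∧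
      -R₀ - 2 ≤ z 2 ∧ z 2 ≤ h + R₀ + 2) := by
    refine filter_congr fun z _ => ?_
    rw [hzlo, hzcut, show -R₀ - 1 - 1 = -R₀ - 2 by ring, show h + R₀ + 1 + 1 = h + R₀ + 2 by ring]
  rw [hPAYeq] at hcast
  -- the sources filter of `card_vertical_tops_ge` is the one of the core (`zlo = −R₀ − 1`)
  have hsrc' : Real.sqrt 2 * α₁ * Real.pi * (ρ - 1) ^ 2 - 10 * Real.sqrt 2 * Real.pi * (ρ - 1) - 36 * R₀ * ρ ≤
      ((P'.filter fun p => (∀ w ∈ fccSlots, p + F false w ∈ X) ∧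
        zlo < (p + F false ustar) 2 ∧ (p + F false ustar) 2 < zcut).card : ℝ) := by
    convert hsources using 4
  -- expand the band bound
  have hα₂ne : α₂ ≠ 0 := hα₂.ne'
  have hband' : ((P₂.filter fun s => zcut ≤ s 2 ∧ s 2 < zcut + α₂).card : ℝ) ≤
      Real.sqrt 2 * α₂ * Real.pi * ρ ^ 2 + 2 * Real.sqrt 2 * Real.pi * K * ρ + Real.sqrt 2 * Real.pi * K ^ 2 / α₂ := by
    have e : Real.sqrt 2 * α₂ * Real.pi * (ρ + K / α₂) ^ 2 =
        Real.sqrt 2 * α₂ * Real.pi * ρ ^ 2 + 2 * Real.sqrt 2 * Real.pi * K * ρ + Real.sqrt 2 * Real.pi * K ^ 2 / α₂ := by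
      field_simp; ring
    rw [← e]; exact hband
  have h2 : 0 ≤ Real.sqrt 2 := Real.sqrt_nonneg _
  have hπ : 0 ≤ Real.pi := Real.pi_pos.le
  have hsq : Real.sqrt 2 * α₁ * Real.pi * (ρ - 1) ^ 2 ≥ Real.sqrt 2 * α₁ * Real.pi * ρ ^ 2 - 2 * Real.sqrt 2 * Real.pi * ρ := by
    have hα₁0 : 0 ≤ α₁ := by rw [hα₁def]; exact hα₁.le
    have : Real.sqrt 2 * α₁ * Real.pi * (ρ - 1) ^ 2 = Real.sqrt 2 * α₁ * Real.pi * ρ ^ 2 -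
        2 * Real.sqrt 2 * α₁ * Real.pi * ρ + Real.sqrt 2 * α₁ * Real.pi := by ring
    rw [this]
    have h1 : Real.sqrt 2 * α₁ * Real.pi * ρ ≤ Real.sqrt 2 * Real.pi * ρ := by
      have := mul_le_mul_of_nonneg_left hα₁le (by positivity : 0 ≤ Real.sqrt 2 * Real.pi * ρ)
      have e1 : Real.sqrt 2 * α₁ * Real.pi * ρ = Real.sqrt 2 * Real.pi * ρ * α₁ := by ring
      rw [mul_one] at this; rw [e1]; exact this
    have h3 : 0 ≤ Real.sqrt 2 * α₁ * Real.pi := mul_nonneg (mul_nonneg h2 hα₁0) hπ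
    linarith
  have hFORbR : ((2 * FORb.card : ℕ) : ℝ) = 2 * (FORb.card : ℝ) := by push_cast; ring
  rw [hFORbR] at hcast
  have h2π : 0 ≤ Real.sqrt 2 * Real.pi := mul_nonneg h2 hπ
  linarith [hcast, hsrc', hband', hrim, hsq]

end Summit.Ventures.Crystal3D.Theorems

end
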